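import Summits.AnomalousDissipation.AnomalousDissipation.Theses.MirrorVariety

/-!
# Birth skeleton (BC3) of the piece `CellLaminarComponentReachesZero` (stmt-AnomalousDissipation-18419; route MirrorVariety,
# strategist split of `GalerkinSteadyZerothLaw`, 2026-08-17)

Two named stubs and a real composition:
* `stub_laminarArc` (PROVABLE NOW, S–M): for `N ≥ 2`, `0 < νa ≤ ν₀` and `E ≥ ½/(8π²νa)²`, the laminar arc segment
  `{(C/(8π²ν), ν) : ν ∈ [νa, ν₀]}` lies in the component `Comp_N(E, ν₀)` of its top point — the cell vector is an exact Euler core and a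
  Stokes eigenvector (`−Δ ↔ 8π²` on the shell `|k|² = 2`), so `C/(8π²ν)` is a real solenoidal `τ`-even zero of the cell-forced Galerkin
  field at every level `N ≥ 2` with energy `½/(8π²ν)²`, and `ν ↦ (C/(8π²ν), ν)` is continuous (tools: `stub_cellCoreTools`,
  `galerkinRHS_scale`, energy of the cell vector `= ½`);
* `stub_branchFromArc` (OPEN — the content of the piece, in the shape bifurcation theory delivers it): with one budget `E` and one arc
  segment `[νa, ν₀]`, for every `ν₁ > 0`, frequently in `N`, a CONNECTED set `Z ⊆ F_N(E)` of bounded `τ`-even steady states touches the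
  laminar arc segment (at the rung where it is born, wherever that is) and contains a state of viscosity `≤ ν₁`;
* `CellLaminarComponentReachesZero_of : stub_laminarArc → stub_branchFromArc → CellLaminarComponentReachesZero` (real proof: `Z` is
  preconnected, meets the component of the arc point, which IS the component of the anchor by `stub_laminarArc`; so `Z ⊆ Comp_N(E,ν₀)`).
-/

namespace Summit.AnomalousDissipation.AnomalousDissipation.Cruxes.CellLaminarComponentReachesZero.Birth

set_option linter.dupNamespace false

open Filter Set
open Summit.AnomalousDissipation.AnomalousDissipation.Theses.MirrorVariety (CellLaminarComponentReachesZero)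

/-- **stub_laminarArc** (provable now): the laminar arc segment above the energy threshold lies in the component of its top point. -/
theorem stub_laminarArc : ∀ C : (Fin 3 → ℤ) → EuclideanSpace ℂ (Fin 3), C = (fun l : Fin 3 → ℤ => if l ∈ Fintype.piFinset ![({1, -1} : Finset ℤ), {1, -1}, {0}] then (Complex.I * (l 0 : ℂ) * (l 1 : ℂ) / 4) • !₂[-((l 1 : ℤ) : ℂ), ((l 0 : ℤ) : ℂ), 0] else 0) → ∀ N : ℕ, 2 ≤ N → ∀ E νa ν₀ : ℝ, 0 < νa → νa ≤ ν₀ → (8 * Real.pi ^ 2 * νa)⁻¹ ^ 2 / 2 ≤ E → ∀ S : Finset (Fin 3 → ℤ), S = (Literature.Analysis.FunctionSpaces.Torus.freqBall N).erase (0 : Fin 3 → ℤ) → ∀ F : Set ((↥S → EuclideanSpace ℂ (Fin 3)) × ℝ), F = {z | z.1 ∈ Literature.Analysis.FluidPDE.galerkinSubspace S ∧ (∀ k : ↥S, Odd ((k : Fin 3 → ℤ) 0 + (k : Fin 3 → ℤ) 1) → z.1 k = 0) ∧ 0 < z.2 ∧ Literature.Analysis.FluidPDE.galerkinRHS S z.2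 (fun k : ↥S => C k) z.1 = 0 ∧ ∑ k : ↥S, ‖z.1 k‖ ^ 2 ≤ E} → ∀ ν ∈ Set.Icc νa ν₀, ((fun k : ↥S => (8 * Real.pi ^ 2 * ν)⁻¹ • C k), ν) ∈ connectedComponentIn F ((fun k : ↥S => (8 * Real.pi ^ 2 * ν₀)⁻¹ • C k), ν₀) := by
  sorry

/-- **stub_branchFromArc** (open): a connected bounded `τ`-even steady family joins the laminar arc segment to viscosity `≤ ν₁`,
frequently in `N`, with ONE energy budget. -/
theorem stub_branchFromArc : ∀ C : (Fin 3 → ℤ) → EuclideanSpace ℂ (Fin 3), C = (fun l : Fin 3 → ℤ => if l ∈ Fintype.piFinset ![({1, -1} : Finset ℤ), {1, -1}, {0}] then (Complex.I * (l 0 : ℂ) * (l 1 : ℂ) / 4) • !₂[-((l 1 : ℤ) : ℂ), ((l 0 : ℤ) : ℂ), 0] else 0) → ∃ E νa ν₀ : ℝ, 0 < νa ∧ νa ≤ ν₀ ∧ (8 * Real.pi ^ 2 * νa)⁻¹ ^ 2 / 2 ≤ E ∧ ∀ ν₁ : ℝ, 0 < ν₁ → ∃ᶠ N in Filter.atTop,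 ∀ S : Finset (Fin 3 → ℤ), S = (Literature.Analysis.FunctionSpaces.Torus.freqBall N).erase (0 : Fin 3 → ℤ) → ∀ F : Set ((↥S → EuclideanSpace ℂ (Fin 3)) × ℝ), F = {z | z.1 ∈ Literature.Analysis.FluidPDE.galerkinSubspace S ∧ (∀ k : ↥S, Odd ((k : Fin 3 → ℤ) 0 + (k : Fin 3 → ℤ) 1) → z.1 k = 0) ∧ 0 < z.2 ∧ Literature.Analysis.FluidPDE.galerkinRHS S z.2 (fun k : ↥S => C k) z.1 = 0 ∧ ∑ k : ↥S, ‖z.1 k‖ ^ 2 ≤ E} → ∃ Z : Set ((↥S → EuclideanSpace ℂ (Fin 3)) × ℝ), Z ⊆ F ∧ IsConnected Z ∧ (∃ ν ∈ Set.Icc νa ν₀, ((fun k : ↥S => (8 * Real.pi ^ 2 * ν)⁻¹ • C k), ν) ∈ Z) ∧ ∃ z ∈ Z, z.2 ≤ ν₁ := by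
  sorry

/-- **Composition**: the piece from the two stubs (topology only). [folklore] -/
theorem CellLaminarComponentReachesZero_of : (∀ C : (Fin 3 → ℤ) → EuclideanSpace ℂ (Fin 3), C = (fun l : Fin 3 → ℤ => if l ∈ Fintype.piFinset ![({1, -1} : Finset ℤ), {1, -1}, {0}] then (Complex.I * (l 0 : ℂ) * (l 1 : ℂ) / 4) • !₂[-((l 1 : ℤ) : ℂ), ((l 0 : ℤ) : ℂ), 0] else 0) → ∀ N : ℕ, 2 ≤ N → ∀ E νa ν₀ : ℝ, 0 < νa → νa ≤ ν₀ → (8 * Real.pi ^ 2 * νa)⁻¹ ^ 2 / 2 ≤ E → ∀ S : Finset (Fin 3 → ℤ), S = (Literature.Analysis.FunctionSpaces.Torus.freqBall N).erase (0 : Fin 3 → ℤ) → ∀ F : Set ((↥S → EuclideanSpace ℂ (Fin 3)) × ℝ), F = {z | z.1 ∈ Literature.Analysis.FluidPDE.galerkinSubspace S ∧ (∀ k : ↥S, Odd ((k : Fin 3 → ℤ) 0 + (k : Fin 3 → ℤ) 1) → z.1 k = 0) ∧ 0 < z.2 ∧ Literature.Analysis.FluidPDE.galerkinRHS S z.2 (fun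 k : ↥S => C k) z.1 = 0 ∧ ∑ k : ↥S, ‖z.1 k‖ ^ 2 ≤ E} → ∀ ν ∈ Set.Icc νa ν₀, ((fun k : ↥S => (8 * Real.pi ^ 2 * ν)⁻¹ • C k), ν) ∈ connectedComponentIn F ((fun k : ↥S => (8 * Real.pi ^ 2 * ν₀)⁻¹ • C k), ν₀)) → (∀ C : (Fin 3 → ℤ) → EuclideanSpace ℂ (Fin 3), C = (fun l : Fin 3 → ℤ => if l ∈ Fintype.piFinset ![({1, -1} : Finset ℤ), {1, -1}, {0}] then (Complex.I * (l 0 : ℂ) * (l 1 : ℂ) / 4) • !₂[-((l 1 : ℤ) : ℂ), ((l 0 : ℤ) : ℂ), 0] else 0) → ∃ E νa ν₀ : ℝ, 0 < νa ∧ νa ≤ ν₀ ∧ (8 * Real.pi ^ 2 * νa)⁻¹ ^ 2 / 2 ≤ E ∧ ∀ ν₁ : ℝ, 0 < ν₁ → ∃ᶠ N in Filter.atTop, ∀ S : Finset (Fin 3 → ℤ), S = (Literature.Analysis.FunctionSpaces.Torus.freqBall N).erase (0 : Fin 3 → ℤ) → ∀ F : Set ((↥S → EuclideanSpace ℂ (Fin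 3)) × ℝ), F = {z | z.1 ∈ Literature.Analysis.FluidPDE.galerkinSubspace S ∧ (∀ k : ↥S, Odd ((k : Fin 3 → ℤ) 0 + (k : Fin 3 → ℤ) 1) → z.1 k = 0) ∧ 0 < z.2 ∧ Literature.Analysis.FluidPDE.galerkinRHS S z.2 (fun k : ↥S => C k) z.1 = 0 ∧ ∑ k : ↥S, ‖z.1 k‖ ^ 2 ≤ E} → ∃ Z : Set ((↥S → EuclideanSpace ℂ (Fin 3)) × ℝ), Z ⊆ F ∧ IsConnected Z ∧ (∃ ν ∈ Set.Icc νa ν₀, ((fun k : ↥S => (8 * Real.pi ^ 2 * ν)⁻¹ • C k), ν) ∈ Z) ∧ ∃ z ∈ Z, z.2 ≤ ν₁) → CellLaminarComponentReachesZero := by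
  intro harc hbr C hC
  obtain ⟨E, νa, ν₀, hνa, hle, hE, h⟩ := hbr C hC
  refine ⟨E, ν₀, hνa.trans_le hle, fun ν₁ hν₁ => ?_⟩
  refine ((h ν₁ hν₁).and_eventually (eventually_ge_atTop 2)).mono ?_
  rintro N ⟨hN, hN2⟩ S hS F hF
  obtain ⟨Z, hZF, hZc, ⟨ν, hν, hνZ⟩, z, hzZ, hzle⟩ := hN S hS F hF
  have hcomp := harc C hC N hN2 E νa ν₀ hνa hle hE S hS F hF ν hν
  have hZsub : Z ⊆ connectedComponentIn F ((fun k : ↥S => (8 * Real.pi ^ 2 * ν)⁻¹ • C k), ν) :=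
    hZc.isPreconnected.subset_connectedComponentIn hνZ hZF
  refine ⟨z, ?_, hzle⟩
  rw [connectedComponentIn_eq hcomp]
  exact hZsub hzZ

/-- The piece from its two (sorried) stubs, by name — usage witness of the composition. [folklore] -/
theorem cellLaminarComponentReachesZero_of_stubs : CellLaminarComponentReachesZero := CellLaminarComponentReachesZero_of stub_laminarArc stub_branchFromArc

end Summit.AnomalousDissipation.AnomalousDissipation.Cruxes.CellLaminarComponentReachesZero.Birth
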